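import Literature.NumberTheory.LFunctions.ZetaLFunctionProductBounds
import Literature.NumberTheory.LFunctions.SmoothEulerProductSandwich
import Mathlib.NumberTheory.LSeries.Nonvanishing
import HarnessLib

/-!
# The coefficients of `ζ(s)L(s,χ)L(s,χ′)L(s,ψ)` for three real characters: non-negativity and
# `a(m²) ≥ 1` (Hoffstein 1980, §3 — the Dedekind zeta function of the biquadratic field)

Topic `Literature/NumberTheory/LFunctions`, namespace `Literature.NumberTheory.LFunctions.Hoffstein1980`.
Everything in this file is PROVED (no named fact). It is the arithmetic section of the discharge of
the tree's named fact `hoffstein1980_theorem1'` (`SiegelTatuzawaExplicit.lean`): J. Hoffstein, *On the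
Siegel–Tatuzawa theorem*, Acta Arith. **38** (1980) 167–174, §3 pp. 170–172. There (proof of Lemma 3
and (7)–(11)) `K = ℚ(√d, √d′)` and "`ζ_K(s) = ζ(s)L(s,χ)L(s,χ′)L(s,χχ′)`", "where the right-hand sum
is over all ideals `𝔞` of `K` with norm `≤ x`. For every integer `n`, `n⁴` is the norm of an ideal"
(p. 171, before (9)). We work directly with the Dirichlet coefficients of the product of the four
`L`-series — the arithmetic function `a = (1 ∗ χ₁) ∗ (χ₂ ∗ χ₃)` (`tripleMul χ₁ χ₂ χ₃`, Mathlib's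
`DirichletCharacter.zetaMul χ₁` convolved with `χ₂ ∗ χ₃`) — and prove, for three quadratic characters
`χ, χ′, ψ` that are LOCALLY LINKED (`LocallyLinked χ χ′ ψ`: at every prime `p`, `ψ(p) = χ(p)χ′(p)` if
`p ∤ qq′`, and `ψ(p) = 0` if `p` divides exactly one of the two conductors — the situation of the
primitive character `ψ` inducing `χχ′`, see `SiegelTatuzawaHoffsteinTripleInducer.lean`):

* `tripleMul_im_eq_zero`, `tripleMul_re_nonneg` — the coefficients are real and `≥ 0`;
* `one_le_tripleMul_sq_re` — **`a(m²) ≥ 1` for every `m ≥ 1`** (the source uses fourth powers,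
  `n⁴ = N((n))`; squares already work: the local factor at `p^{2i}` contains the term
  `(1∗χ₁)(p^{2i})·(χ₂∗χ₃)(1) ≥ 1`).

Method (deviation from the printed ideal-theoretic argument, recorded): at a prime `p` with values
`u = χ₁(p)`, `v = χ₂(p)`, `w = χ₃(p) ∈ {0, ±1}` the local coefficients are
`a(p^k) = Σ_{i ≤ k} A_i(u) B_{k−i}(v, w)` with `A_i(u) = Σ_{l ≤ i} u^l ≥ 0` (`≥ 1` for even `i`) and
`B_j(v,w) = Σ_{l ≤ j} v^l w^{j−l}` (`pairSum`), which is `≥ 0` for the GOOD pairs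
`(v, w) ∉ {(−1,0), (0,−1), (−1,−1)}`; local linkage guarantees that after a permutation of the three
characters (the product is symmetric: `tripleMul_swap`, `tripleMul_rotate`) the last pair is good
(`tripleMul_prime_pow_re_of_linked`). Multiplicativity (`isMultiplicative_tripleMul`) globalises.

## References

* J. Hoffstein, On the Siegel–Tatuzawa theorem, Acta Arith. 38 (1980) 167–174, §3 (proof of
  Lemma 3; (9)), pp. 170–171. [Hoffstein1980SiegelTatuzawa]
-/

noncomputable section

open Complex Finset ArithmeticFunction DirichletCharacter

namespace Literature.NumberTheory.LFunctions.Hoffstein1980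

open Literature.NumberTheory.LFunctions.SmoothEulerProduct

/-! ### The local sums `B_j(a,b) = Σ_{l ≤ j} a^l b^{j−l}` -/

/-- `B_j(a, b) = Σ_{l ≤ j} a^l b^{j−l}` — the coefficient of `X^j` in `1/((1 − aX)(1 − bX))`, i.e. the
value of `χ₂ ∗ χ₃` at `p^j` when `a = χ₂(p)`, `b = χ₃(p)`. [cite: Hoffstein1980SiegelTatuzawa, §3 p. 171] -/
def pairSum (a b : ℝ) (j : ℕ) : ℝ := ∑ l ∈ range (j + 1), a ^ l * b ^ (j - l)

/-- `B_0 = 1`. [folklore] -/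
private theorem pairSum_zero (a b : ℝ) : pairSum a b 0 = 1 := by simp [pairSum]

/-- `B_j(a, b) ≥ 0` when `a, b ≥ 0`. [folklore] -/
private theorem pairSum_nonneg_of_nonneg {a b : ℝ} (ha : 0 ≤ a) (hb : 0 ≤ b) (j : ℕ) : 0 ≤ pairSum a b j :=
  sum_nonneg fun l _ ↦ mul_nonneg (pow_nonneg ha l) (pow_nonneg hb _)

/-- `B_j(a, 1) = Σ_{l ≤ j} a^l` (the geometric sum; the value of `1 ∗ χ` at `p^j`). [folklore] -/
private theorem pairSum_one_right (a : ℝ) (j : ℕ) : pairSum a 1 j = ∑ l ∈ range (j + 1), a ^ l := by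
  simp [pairSum]

/-- `B_j(1, b) = Σ_{l ≤ j} b^l`. [folklore] -/
private theorem pairSum_one_left (b : ℝ) (j : ℕ) : pairSum 1 b j = ∑ l ∈ range (j + 1), b ^ l := by
  unfold pairSum
  simp only [one_pow, one_mul]
  rw [← Finset.sum_range_reflect]
  refine sum_congr rfl fun l hl ↦ ?_
  rw [mem_range] at hl
  congr 1
  omega

/-- `Σ_{l ≤ j} (−1)^l ∈ {0, 1}`, in particular `≥ 0`, and `= 1` for even `j`. [folklore] -/
private theorem neg_one_geom_sum_nonneg (j : ℕ) : 0 ≤ ∑ l ∈ range (j + 1), (-1 : ℝ) ^ l := by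
  rw [neg_one_geom_sum]; split_ifs <;> norm_num

/-- `Σ_{l ≤ 2i} (−1)^l = 1`. [folklore] -/
private theorem neg_one_geom_sum_even {j : ℕ} (hj : Even j) : ∑ l ∈ range (j + 1), (-1 : ℝ) ^ l = 1 := by
  rw [neg_one_geom_sum, if_neg (by simpa [Nat.even_add_one] using hj)]

/-- The geometric sums `Σ_{l ≤ j} c^l` for `c ∈ {0, 1, −1}` are `≥ 0`. [folklore] -/
private theorem geom_sum_nonneg_of_trichotomy {c : ℝ} (hc : c = 0 ∨ c = 1 ∨ c = -1) (j : ℕ) :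
    0 ≤ ∑ l ∈ range (j + 1), c ^ l := by
  rcases hc with rfl | rfl | rfl
  · exact sum_nonneg fun l _ ↦ pow_nonneg le_rfl l
  · exact sum_nonneg fun l _ ↦ pow_nonneg zero_le_one l
  · exact neg_one_geom_sum_nonneg j

/-- The geometric sums `Σ_{l ≤ j} c^l` for `c ∈ {0, 1, −1}` and EVEN `j` are `≥ 1` ("`n⁴` is the norm of
an ideal" — here already `n²`). [cite: Hoffstein1980SiegelTatuzawa, §3 p. 171] -/
theorem one_le_geom_sum_of_trichotomy {c : ℝ} (hc : c = 0 ∨ c = 1 ∨ c = -1) {j : ℕ} (hj : Even j) :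
    1 ≤ ∑ l ∈ range (j + 1), c ^ l := by
  rcases hc with rfl | rfl | rfl
  · rw [sum_range_succ']; simp
  · simp
  · rw [neg_one_geom_sum_even hj]

/-- **Good pairs**: `(a, b) ∈ {0, ±1}²` outside `{(−1,0), (0,−1), (−1,−1)}`, i.e. both `≥ 0`, or
`{a, b} = {1, −1}`. For these `B_j(a,b) ≥ 0` for all `j`. [cite: Hoffstein1980SiegelTatuzawa, §3 p. 171] -/
def GoodPair (a b : ℝ) : Prop := (0 ≤ a ∧ 0 ≤ b) ∨ (a = 1 ∧ b = -1) ∨ (a = -1 ∧ b = 1)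

/-- `B_j(a, b) ≥ 0` for a good pair. [cite: Hoffstein1980SiegelTatuzawa, §3 p. 171] -/
theorem pairSum_nonneg_of_good {a b : ℝ} (h : GoodPair a b) (j : ℕ) : 0 ≤ pairSum a b j := by
  rcases h with ⟨ha, hb⟩ | ⟨rfl, rfl⟩ | ⟨rfl, rfl⟩
  · exact pairSum_nonneg_of_nonneg ha hb j
  · rw [pairSum_one_left]; exact neg_one_geom_sum_nonneg j
  · rw [pairSum_one_right]; exact neg_one_geom_sum_nonneg j

/-! ### The arithmetic functions `χ₂ ∗ χ₃` and `a = (1 ∗ χ₁) ∗ (χ₂ ∗ χ₃)` -/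

variable {q₁ q₂ q₃ : ℕ}

/-- `χ₂ ∗ χ₃` as an arithmetic function (Dirichlet convolution of the value functions).
[cite: Hoffstein1980SiegelTatuzawa, §3 p. 170] -/
def pairConv (χ₂ : DirichletCharacter ℂ q₂) (χ₃ : DirichletCharacter ℂ q₃) : ArithmeticFunction ℂ :=
  toArithmeticFunction (χ₂ ·) * toArithmeticFunction (χ₃ ·)

/-- **The coefficients of `ζ(s)L(s,χ₁)L(s,χ₂)L(s,χ₃)`**: `a = (1 ∗ χ₁) ∗ (χ₂ ∗ χ₃)` (for the
biquadratic field, the ideal-counting function `n ↦ #{𝔞 : N𝔞 = n}`).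
[cite: Hoffstein1980SiegelTatuzawa, §3 p. 171] -/
def tripleMul (χ₁ : DirichletCharacter ℂ q₁) (χ₂ : DirichletCharacter ℂ q₂)
    (χ₃ : DirichletCharacter ℂ q₃) : ArithmeticFunction ℂ :=
  χ₁.zetaMul * pairConv χ₂ χ₃

/-- Symmetry: `a` does not depend on the order of the three characters (swap of the first two).
[cite: Hoffstein1980SiegelTatuzawa, §3 p. 170] -/
theorem tripleMul_swap (χ₁ : DirichletCharacter ℂ q₁) (χ₂ : DirichletCharacter ℂ q₂)
    (χ₃ : DirichletCharacter ℂ q₃) : tripleMul χ₁ χ₂ χ₃ = tripleMul χ₂ χ₁ χ₃ := by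
  simp only [tripleMul, pairConv, DirichletCharacter.zetaMul]; ring

/-- Symmetry: `a` does not depend on the order of the three characters (cyclic rotation).
[cite: Hoffstein1980SiegelTatuzawa, §3 p. 170] -/
theorem tripleMul_rotate (χ₁ : DirichletCharacter ℂ q₁) (χ₂ : DirichletCharacter ℂ q₂)
    (χ₃ : DirichletCharacter ℂ q₃) : tripleMul χ₁ χ₂ χ₃ = tripleMul χ₃ χ₁ χ₂ := by
  simp only [tripleMul, pairConv, DirichletCharacter.zetaMul]; ring

/-- `a` is multiplicative. [cite: Hoffstein1980SiegelTatuzawa, §3 p. 171] -/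
theorem isMultiplicative_tripleMul (χ₁ : DirichletCharacter ℂ q₁) (χ₂ : DirichletCharacter ℂ q₂)
    (χ₃ : DirichletCharacter ℂ q₃) : (tripleMul χ₁ χ₂ χ₃).IsMultiplicative :=
  (isMultiplicative_zetaMul χ₁).mul
    ((isMultiplicative_toArithmeticFunction χ₂).mul (isMultiplicative_toArithmeticFunction χ₃))

/-- Values of a Dirichlet convolution at prime powers: `(f ∗ g)(p^k) = Σ_{i ≤ k} f(p^i) g(p^{k−i})`. [folklore] -/
private theorem mul_apply_prime_pow (f g : ArithmeticFunction ℂ) {p : ℕ} (hp : p.Prime) (k : ℕ) :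
    (f * g) (p ^ k) = ∑ i ∈ range (k + 1), f (p ^ i) * g (p ^ (k - i)) := by
  rw [mul_apply, Nat.sum_divisorsAntidiagonal (fun a b => f a * g b), Nat.divisors_prime_pow hp k,
    Finset.sum_map]
  refine Finset.sum_congr rfl fun i hi => ?_
  rw [Finset.mem_range] at hi
  simp only [Function.Embedding.coeFn_mk]
  rw [Nat.pow_div (by omega) hp.pos]

/-- `χ(p^i) = χ(p)^i` for the associated arithmetic function. [folklore] -/
private theorem toArithmeticFunction_prime_pow (χ : DirichletCharacter ℂ q₁) {p : ℕ} (hp : p.Prime) (i : ℕ) :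
    toArithmeticFunction (χ ·) (p ^ i) = (χ p) ^ i := by
  simp [toArithmeticFunction, hp.ne_zero]

/-- `(1 ∗ χ)(p^i) = Σ_{l ≤ i} χ(p)^l`. [folklore] -/
private theorem zetaMul_prime_pow (χ : DirichletCharacter ℂ q₁) {p : ℕ} (hp : p.Prime) (i : ℕ) :
    χ.zetaMul (p ^ i) = ∑ l ∈ range (i + 1), (χ p) ^ l := by
  simp only [DirichletCharacter.zetaMul, toArithmeticFunction, coe_zeta_mul_apply, coe_mk,
    Nat.sum_divisors_prime_pow hp, pow_eq_zero_iff', hp.ne_zero, ne_eq, false_and, ↓reduceIte,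
    Nat.cast_pow, map_pow]

/-- `(χ₂ ∗ χ₃)(p^j) = Σ_{l ≤ j} χ₂(p)^l χ₃(p)^{j−l}`. [folklore] -/
private theorem pairConv_prime_pow (χ₂ : DirichletCharacter ℂ q₂) (χ₃ : DirichletCharacter ℂ q₃) {p : ℕ}
    (hp : p.Prime) (j : ℕ) :
    pairConv χ₂ χ₃ (p ^ j) = ∑ l ∈ range (j + 1), (χ₂ p) ^ l * (χ₃ p) ^ (j - l) := by
  unfold pairConv
  rw [mul_apply_prime_pow _ _ hp]
  refine sum_congr rfl fun l _ ↦ ?_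
  rw [toArithmeticFunction_prime_pow χ₂ hp, toArithmeticFunction_prime_pow χ₃ hp]

/-- `a(p^k) = Σ_{i ≤ k} (1∗χ₁)(p^i) · (χ₂∗χ₃)(p^{k−i})`. [folklore] -/
private theorem tripleMul_prime_pow (χ₁ : DirichletCharacter ℂ q₁) (χ₂ : DirichletCharacter ℂ q₂)
    (χ₃ : DirichletCharacter ℂ q₃) {p : ℕ} (hp : p.Prime) (k : ℕ) :
    tripleMul χ₁ χ₂ χ₃ (p ^ k) =
      ∑ i ∈ range (k + 1), χ₁.zetaMul (p ^ i) * pairConv χ₂ χ₃ (p ^ (k - i)) := by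
  unfold tripleMul
  exact mul_apply_prime_pow _ _ hp k

/-! ### Quadratic characters: real local values -/

/-- For quadratic `χ₂, χ₃`: `(χ₂ ∗ χ₃)(p^j) = B_j(Re χ₂(p), Re χ₃(p))` (a real number). [folklore] -/
private theorem pairConv_prime_pow_eq_ofReal {χ₂ : DirichletCharacter ℂ q₂} {χ₃ : DirichletCharacter ℂ q₃}
    (h₂ : χ₂ ^ 2 = 1) (h₃ : χ₃ ^ 2 = 1) {p : ℕ} (hp : p.Prime) (j : ℕ) :
    pairConv χ₂ χ₃ (p ^ j) = ((pairSum (χ₂ p).re (χ₃ p).re j : ℝ) : ℂ) := by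
  rw [pairConv_prime_pow χ₂ χ₃ hp, pairSum]
  push_cast
  refine sum_congr rfl fun l _ ↦ ?_
  rw [← apply_eq_re χ₂ h₂ p, ← apply_eq_re χ₃ h₃ p]

/-- For quadratic `χ₁`: `(1 ∗ χ₁)(p^i) = B_i(Re χ₁(p), 1) = Σ_{l ≤ i} (Re χ₁(p))^l`. [folklore] -/
private theorem zetaMul_prime_pow_eq_ofReal {χ₁ : DirichletCharacter ℂ q₁} (h₁ : χ₁ ^ 2 = 1) {p : ℕ}
    (hp : p.Prime) (i : ℕ) :
    χ₁.zetaMul (p ^ i) = ((pairSum (χ₁ p).re 1 i : ℝ) : ℂ) := by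
  rw [zetaMul_prime_pow χ₁ hp, pairSum_one_right]
  push_cast
  refine sum_congr rfl fun l _ ↦ ?_
  rw [← apply_eq_re χ₁ h₁ p]

/-- For quadratic `χ₁, χ₂, χ₃`: `a(p^k) = Σ_{i ≤ k} B_i(u,1) B_{k−i}(v,w)` with `u, v, w` the (real)
values at `p`. [cite: Hoffstein1980SiegelTatuzawa, §3 p. 171] -/
theorem tripleMul_prime_pow_eq_ofReal {χ₁ : DirichletCharacter ℂ q₁} {χ₂ : DirichletCharacter ℂ q₂}
    {χ₃ : DirichletCharacter ℂ q₃} (h₁ : χ₁ ^ 2 = 1) (h₂ : χ₂ ^ 2 = 1) (h₃ : χ₃ ^ 2 = 1) {p : ℕ}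
    (hp : p.Prime) (k : ℕ) :
    tripleMul χ₁ χ₂ χ₃ (p ^ k) =
      ((∑ i ∈ range (k + 1), pairSum (χ₁ p).re 1 i * pairSum (χ₂ p).re (χ₃ p).re (k - i) : ℝ) : ℂ) := by
  rw [tripleMul_prime_pow _ _ _ hp]
  push_cast
  refine sum_congr rfl fun i _ ↦ ?_
  rw [zetaMul_prime_pow_eq_ofReal h₁ hp, pairConv_prime_pow_eq_ofReal h₂ h₃ hp]

/-- **The local coefficients for a good last pair**: if `(Re χ₂(p), Re χ₃(p))` is a good pair then
`a(p^k)` is real, `≥ 0`, and `≥ 1` for even `k` (the term `i = k`: `B_k(u,1) · B_0 ≥ 1 · 1`).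
[cite: Hoffstein1980SiegelTatuzawa, §3 p. 171] -/
theorem tripleMul_prime_pow_re_of_good {χ₁ : DirichletCharacter ℂ q₁} {χ₂ : DirichletCharacter ℂ q₂}
    {χ₃ : DirichletCharacter ℂ q₃} (h₁ : χ₁ ^ 2 = 1) (h₂ : χ₂ ^ 2 = 1) (h₃ : χ₃ ^ 2 = 1) {p : ℕ}
    (hp : p.Prime) (hgood : GoodPair (χ₂ p).re (χ₃ p).re) (k : ℕ) :
    (tripleMul χ₁ χ₂ χ₃ (p ^ k)).im = 0 ∧ 0 ≤ (tripleMul χ₁ χ₂ χ₃ (p ^ k)).re ∧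
      (Even k → 1 ≤ (tripleMul χ₁ χ₂ χ₃ (p ^ k)).re) := by
  rw [tripleMul_prime_pow_eq_ofReal h₁ h₂ h₃ hp, ofReal_im, ofReal_re]
  have hu := apply_re_trichotomy χ₁ h₁ p
  have hA : ∀ i, 0 ≤ pairSum (χ₁ p).re 1 i := fun i ↦ by
    rw [pairSum_one_right]; exact geom_sum_nonneg_of_trichotomy hu i
  have hB : ∀ j, 0 ≤ pairSum (χ₂ p).re (χ₃ p).re j := pairSum_nonneg_of_good hgood
  have hterm : ∀ i ∈ range (k + 1), 0 ≤ pairSum (χ₁ p).re 1 i * pairSum (χ₂ p).re (χ₃ p).re (k - i) :=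
    fun i _ ↦ mul_nonneg (hA i) (hB _)
  refine ⟨rfl, sum_nonneg hterm, fun hk ↦ ?_⟩
  have hk' : k ∈ range (k + 1) := by simp
  refine le_trans ?_ (single_le_sum hterm hk')
  rw [Nat.sub_self, pairSum_zero, mul_one, pairSum_one_right]
  exact one_le_geom_sum_of_trichotomy hu hk

/-! ### Locally linked triples -/

/-- **Local linkage** of three characters `χ, χ′, ψ` (of possibly different moduli): at every prime
`p`, `ψ(p) = χ(p)χ′(p)` when `χ(p), χ′(p) ≠ 0`, and `ψ(p) = 0` when exactly one of `χ(p), χ′(p)`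
vanishes. This is the local behaviour of the primitive character `ψ` inducing `χχ′` for primitive
`χ, χ′` (`SiegelTatuzawaHoffsteinTripleInducer.lean`); it is exactly what makes the coefficients of
`ζ·L_χ·L_χ′·L_ψ` non-negative. [cite: Hoffstein1980SiegelTatuzawa, §3 p. 170] -/
def LocallyLinked (χ : DirichletCharacter ℂ q₁) (χ' : DirichletCharacter ℂ q₂)
    (ψ : DirichletCharacter ℂ q₃) : Prop :=
  ∀ p : ℕ, p.Prime →
    (χ p ≠ 0 → χ' p ≠ 0 → ψ p = χ p * χ' p) ∧ (χ p = 0 → χ' p ≠ 0 → ψ p = 0) ∧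
      (χ' p = 0 → χ p ≠ 0 → ψ p = 0)

/-- Real-part form of a vanishing value of a quadratic character. [folklore] -/
private lemma apply_eq_zero_iff_re {χ : DirichletCharacter ℂ q₁} (h : χ ^ 2 = 1) (p : ℕ) :
    χ p = 0 ↔ (χ p).re = 0 := by
  constructor
  · intro h0; rw [h0]; simp
  · intro h0; rw [apply_eq_re χ h p, h0]; simp

/-- **The local coefficients of a locally linked quadratic triple**: `a(p^k)` is real, `≥ 0`, and `≥ 1`
for even `k`. Case analysis: if `(χ′(p), ψ(p))` is a good pair, use the order `(χ, χ′, ψ)`; the bad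
pairs `(−1,−1)`, `(−1,0)`, `(0,−1)` force, by linkage, `χ(p) = 1`, `0`, `0` respectively, and then the
orders `(χ′, χ, ψ)`, `(χ′, χ, ψ)`, `(ψ, χ, χ′)` end in the good pairs `(1,−1)`, `(0,0)`, `(0,0)`.
[cite: Hoffstein1980SiegelTatuzawa, §3 p. 171] -/
theorem tripleMul_prime_pow_re_of_linked {χ : DirichletCharacter ℂ q₁} {χ' : DirichletCharacter ℂ q₂}
    {ψ : DirichletCharacter ℂ q₃} (h₁ : χ ^ 2 = 1) (h₂ : χ' ^ 2 = 1) (h₃ : ψ ^ 2 = 1)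
    (hlink : LocallyLinked χ χ' ψ) {p : ℕ} (hp : p.Prime) (k : ℕ) :
    (tripleMul χ χ' ψ (p ^ k)).im = 0 ∧ 0 ≤ (tripleMul χ χ' ψ (p ^ k)).re ∧
      (Even k → 1 ≤ (tripleMul χ χ' ψ (p ^ k)).re) := by
  obtain ⟨hl1, hl2, hl3⟩ := hlink p hp
  have hu := apply_re_trichotomy χ h₁ p
  have hv := apply_re_trichotomy χ' h₂ p
  have hw := apply_re_trichotomy ψ h₃ p
  have hu0 := apply_eq_zero_iff_re h₁ p
  have hv0 := apply_eq_zero_iff_re h₂ p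
  have hw0 := apply_eq_zero_iff_re h₃ p
  -- the product rule in real form
  have hprod : χ p ≠ 0 → χ' p ≠ 0 → (ψ p).re = (χ p).re * (χ' p).re := fun ha hb ↦ by
    rw [hl1 ha hb, apply_eq_re χ h₁ p, apply_eq_re χ' h₂ p, ← ofReal_mul, ofReal_re, ofReal_re, ofReal_re]
  by_cases hgood : GoodPair (χ' p).re (ψ p).re
  · exact tripleMul_prime_pow_re_of_good h₁ h₂ h₃ hp hgood k
  · -- the bad pairs
    have hbad : ((χ' p).re = -1 ∧ (ψ p).re = -1) ∨ ((χ' p).re = -1 ∧ (ψ p).re = 0) ∨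
        ((χ' p).re = 0 ∧ (ψ p).re = -1) := by
      have key : ∀ v w : ℝ, (v = 0 ∨ v = 1 ∨ v = -1) → (w = 0 ∨ w = 1 ∨ w = -1) → ¬ GoodPair v w →
          (v = -1 ∧ w = -1) ∨ (v = -1 ∧ w = 0) ∨ (v = 0 ∧ w = -1) := by
        intro v w hv' hw' hg
        simp only [GoodPair] at hg
        rcases hv' with rfl | rfl | rfl <;> rcases hw' with rfl | rfl | rfl <;> norm_num at hg <;> norm_num
      exact key _ _ hv hw hgood
    rcases hbad with ⟨hv1, hw1⟩ | ⟨hv1, hw1⟩ | ⟨hv1, hw1⟩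
    · -- `(v, w) = (−1, −1)` ⇒ `u = 1`; order `(χ′, χ, ψ)`, last pair `(1, −1)`
      have hb : χ' p ≠ 0 := fun h ↦ by rw [hv0.1 h] at hv1; norm_num at hv1
      have ha : χ p ≠ 0 := fun h ↦ by
        have := hl2 h hb; rw [hw0.1 this] at hw1; norm_num at hw1
      have hu1 : (χ p).re = 1 := by
        have := hprod ha hb; rw [hw1, hv1] at this; linarith
      rw [tripleMul_swap]
      exact tripleMul_prime_pow_re_of_good h₂ h₁ h₃ hp (Or.inr (Or.inl ⟨hu1, hw1⟩)) k
    · -- `(v, w) = (−1, 0)` ⇒ `u = 0`; order `(χ′, χ, ψ)`, last pair `(0, 0)`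
      have hb : χ' p ≠ 0 := fun h ↦ by rw [hv0.1 h] at hv1; norm_num at hv1
      have hu1 : (χ p).re = 0 := by
        by_contra ha'
        have ha : χ p ≠ 0 := fun h ↦ ha' (hu0.1 h)
        have := hprod ha hb
        rw [hw1, hv1] at this
        rcases hu with hu | hu | hu <;> rw [hu] at this <;> norm_num at this
        exact ha' hu
      rw [tripleMul_swap]
      exact tripleMul_prime_pow_re_of_good h₂ h₁ h₃ hp (Or.inl ⟨by rw [hu1], by rw [hw1]⟩) k
    · -- `(v, w) = (0, −1)` ⇒ `u = 0`; order `(ψ, χ, χ′)`, last pair `(0, 0)`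
      have hb : χ' p = 0 := hv0.2 hv1
      have hu1 : (χ p).re = 0 := by
        by_contra ha'
        have ha : χ p ≠ 0 := fun h ↦ ha' (hu0.1 h)
        have := hl3 hb ha
        rw [hw0.1 this] at hw1; norm_num at hw1
      rw [tripleMul_rotate]
      exact tripleMul_prime_pow_re_of_good h₃ h₁ h₂ hp (Or.inl ⟨by rw [hu1], by rw [hv1]⟩) k

/-! ### Globalisation by multiplicativity -/

variable {χ : DirichletCharacter ℂ q₁} {χ' : DirichletCharacter ℂ q₂} {ψ : DirichletCharacter ℂ q₃}

/-- **The coefficients are real.** [cite: Hoffstein1980SiegelTatuzawa, §3 p. 171] -/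
theorem tripleMul_im_eq_zero (h₁ : χ ^ 2 = 1) (h₂ : χ' ^ 2 = 1) (h₃ : ψ ^ 2 = 1)
    (hlink : LocallyLinked χ χ' ψ) (n : ℕ) : (tripleMul χ χ' ψ n).im = 0 := by
  induction n using Nat.recOnPrimeCoprime with
  | zero => simp
  | prime_pow p k hp => exact (tripleMul_prime_pow_re_of_linked h₁ h₂ h₃ hlink hp k).1
  | coprime a b ha hb hab iha ihb =>
    rw [(isMultiplicative_tripleMul χ χ' ψ).map_mul_of_coprime hab, mul_im, iha, ihb]
    ring

/-- Multiplicativity of the real parts on coprime arguments (the coefficients being real).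
[cite: Hoffstein1980SiegelTatuzawa, §3 p. 171] -/
theorem tripleMul_re_mul (h₁ : χ ^ 2 = 1) (h₂ : χ' ^ 2 = 1) (h₃ : ψ ^ 2 = 1)
    (hlink : LocallyLinked χ χ' ψ) {m n : ℕ} (h : m.Coprime n) :
    (tripleMul χ χ' ψ (m * n)).re = (tripleMul χ χ' ψ m).re * (tripleMul χ χ' ψ n).re := by
  rw [(isMultiplicative_tripleMul χ χ' ψ).map_mul_of_coprime h, mul_re,
    tripleMul_im_eq_zero h₁ h₂ h₃ hlink m, zero_mul, sub_zero]

/-- **The coefficients are non-negative** ("the right-hand sum is over all ideals").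
[cite: Hoffstein1980SiegelTatuzawa, §3 p. 171] -/
theorem tripleMul_re_nonneg (h₁ : χ ^ 2 = 1) (h₂ : χ' ^ 2 = 1) (h₃ : ψ ^ 2 = 1)
    (hlink : LocallyLinked χ χ' ψ) (n : ℕ) : 0 ≤ (tripleMul χ χ' ψ n).re := by
  induction n using Nat.recOnPrimeCoprime with
  | zero => simp
  | prime_pow p k hp => exact (tripleMul_prime_pow_re_of_linked h₁ h₂ h₃ hlink hp k).2.1
  | coprime a b ha hb hab iha ihb =>
    rw [tripleMul_re_mul h₁ h₂ h₃ hlink hab]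
    exact mul_nonneg iha ihb

/-- **`a(m²) ≥ 1` for every `m ≥ 1`** ("for every integer `n`, `n⁴` is the norm of an ideal" — squares
suffice, see the module docstring). [cite: Hoffstein1980SiegelTatuzawa, §3 (9) p. 171] -/
theorem one_le_tripleMul_sq_re (h₁ : χ ^ 2 = 1) (h₂ : χ' ^ 2 = 1) (h₃ : ψ ^ 2 = 1)
    (hlink : LocallyLinked χ χ' ψ) {m : ℕ} (hm : 1 ≤ m) : 1 ≤ (tripleMul χ χ' ψ (m ^ 2)).re := by
  induction m using Nat.recOnPrimeCoprime with
  | zero => omega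
  | prime_pow p k hp =>
    rw [← pow_mul]
    exact (tripleMul_prime_pow_re_of_linked h₁ h₂ h₃ hlink hp (k * 2)).2.2 ⟨k, by ring⟩
  | coprime a b ha hb hab iha ihb =>
    rw [mul_pow, tripleMul_re_mul h₁ h₂ h₃ hlink (hab.pow 2 2)]
    have h1 := iha (by omega)
    have h2 := ihb (by omega)
    nlinarith

/-- The coefficient is the real number `Re a(n)` (as a complex number). [cite: Hoffstein1980SiegelTatuzawa, §3 p. 171] -/
theorem tripleMul_eq_ofReal_re (h₁ : χ ^ 2 = 1) (h₂ : χ' ^ 2 = 1) (h₃ : ψ ^ 2 = 1)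
    (hlink : LocallyLinked χ χ' ψ) (n : ℕ) :
    tripleMul χ χ' ψ n = (((tripleMul χ χ' ψ n).re : ℝ) : ℂ) := by
  apply Complex.ext
  · simp
  · simp [tripleMul_im_eq_zero h₁ h₂ h₃ hlink n]

/-! ### The `L`-series of `a` is `ζ(s) L(s,χ₁) L(s,χ₂) L(s,χ₃)` for `Re s > 1` -/

/-- Summability of `Σ χ(n) n^{-s}` in arithmetic-function clothing, `Re s > 1`. [folklore] -/
private lemma LSeriesSummable_toAF (χ₂ : DirichletCharacter ℂ q₂) {s : ℂ} (hs : 1 < s.re) :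
    LSeriesSummable (toArithmeticFunction (χ₂ ·) ·) s :=
  (LSeriesSummable_congr _ fun h ↦ (χ₂.apply_eq_toArithmeticFunction_apply h).symm).mpr <|
    DirichletCharacter.LSeriesSummable_of_one_lt_re χ₂ hs

/-- `LSeries (χ₂ as arithmetic function) = L(s, χ₂)` for `Re s > 1`. [folklore] -/
private lemma LSeries_toAF_eq [NeZero q₂] (χ₂ : DirichletCharacter ℂ q₂) {s : ℂ} (hs : 1 < s.re) :
    LSeries (toArithmeticFunction (χ₂ ·) ·) s = χ₂.LFunction s := by
  rw [χ₂.LFunction_eq_LSeries hs]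
  exact (LSeries_congr (fun h ↦ (χ₂.apply_eq_toArithmeticFunction_apply h).symm) s)

/-- **Absolute convergence of `Σ a(n) n^{-s}` for `Re s > 1`.** [cite: Hoffstein1980SiegelTatuzawa, §3 p. 171] -/
theorem LSeriesSummable_tripleMul (χ₁ : DirichletCharacter ℂ q₁) (χ₂ : DirichletCharacter ℂ q₂)
    (χ₃ : DirichletCharacter ℂ q₃) {s : ℂ} (hs : 1 < s.re) :
    LSeriesSummable (tripleMul χ₁ χ₂ χ₃ ·) s := by
  unfold tripleMul pairConv
  exact ArithmeticFunction.LSeriesSummable_mul (χ₁.LSeriesSummable_zetaMul hs)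
    (ArithmeticFunction.LSeriesSummable_mul (LSeriesSummable_toAF χ₂ hs) (LSeriesSummable_toAF χ₃ hs))

/-- `Σ ‖a(n) n^{-s}‖ < ∞` for `Re s > 1`. [cite: Hoffstein1980SiegelTatuzawa, §3 p. 171] -/
theorem summable_norm_term_tripleMul (χ₁ : DirichletCharacter ℂ q₁) (χ₂ : DirichletCharacter ℂ q₂)
    (χ₃ : DirichletCharacter ℂ q₃) {s : ℂ} (hs : 1 < s.re) :
    Summable fun n : ℕ ↦ ‖LSeries.term (tripleMul χ₁ χ₂ χ₃ ·) s n‖ :=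
  summable_norm_iff.mpr (LSeriesSummable_tripleMul χ₁ χ₂ χ₃ hs)

/-- **`Σ a(n) n^{-s} = ζ(s) L(s,χ₁) L(s,χ₂) L(s,χ₃)` for `Re s > 1`** ("`ζ_K(s) = ζ(s)L(s,χ)L(s,χ′)L(s,χχ′)`",
§3 proof of Lemma 3). [cite: Hoffstein1980SiegelTatuzawa, §3 p. 170] -/
theorem LSeries_tripleMul_eq [NeZero q₁] [NeZero q₂] [NeZero q₃] (χ₁ : DirichletCharacter ℂ q₁)
    (χ₂ : DirichletCharacter ℂ q₂) (χ₃ : DirichletCharacter ℂ q₃) {s : ℂ} (hs : 1 < s.re) :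
    LSeries (tripleMul χ₁ χ₂ χ₃ ·) s =
      riemannZeta s * χ₁.LFunction s * (χ₂.LFunction s * χ₃.LFunction s) := by
  have h1 := χ₁.LSeriesSummable_zetaMul hs
  have h2 := LSeriesSummable_toAF χ₂ hs
  have h3 := LSeriesSummable_toAF χ₃ hs
  have h23 : LSeriesSummable (pairConv χ₂ χ₃ ·) s := ArithmeticFunction.LSeriesSummable_mul h2 h3
  have e1 : LSeries (tripleMul χ₁ χ₂ χ₃ ·) s = LSeries (χ₁.zetaMul ·) s * LSeries (pairConv χ₂ χ₃ ·) s :=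
    ArithmeticFunction.LSeries_mul' h1 h23
  have e2 : LSeries (pairConv χ₂ χ₃ ·) s = χ₂.LFunction s * χ₃.LFunction s := by
    rw [← LSeries_toAF_eq χ₂ hs, ← LSeries_toAF_eq χ₃ hs]
    exact ArithmeticFunction.LSeries_mul' h2 h3
  have e3 : LSeries (χ₁.zetaMul ·) s = riemannZeta s * χ₁.LFunction s := (zetaL_eq_LSeries χ₁ hs).symm
  rw [e1, e2, e3]


/-! ### The primitive character inducing `χχ′` is locally linked to `(χ, χ′)` -/

section Inducer

variable {q q' : ℕ}

/-- A value criterion on natural numbers: `χ(m) = 0 ↔ ¬ (m, n) = 1`. [folklore] -/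
private theorem apply_natCast_eq_zero_iff {n : ℕ} (χ₀ : DirichletCharacter ℂ n) (m : ℕ) :
    χ₀ m = 0 ↔ ¬ Nat.Coprime m n := by
  rw [← Nat.isCoprime_iff_coprime, ← DirichletCharacter.apply_eq_zero_iff χ₀ (m : ℤ), Int.cast_natCast]

/-- `χχ′` as a Dirichlet character modulo `qq′` (both factors lifted to level `qq′`).
[cite: Hoffstein1980SiegelTatuzawa, §3 proof of Lemma 3 p. 170] -/
def prodChar (χ : DirichletCharacter ℂ q) (χ' : DirichletCharacter ℂ q') : DirichletCharacter ℂ (q * q') :=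
  changeLevel (dvd_mul_right q q') χ * changeLevel (dvd_mul_left q' q) χ'

variable (χ : DirichletCharacter ℂ q) (χ' : DirichletCharacter ℂ q')

/-- Values of `χχ′` at integers coprime to `qq′`: `(χχ′)(m) = χ(m)χ′(m)`.
[cite: Hoffstein1980SiegelTatuzawa, §3 proof of Lemma 3 p. 170] -/
theorem prodChar_apply_of_coprime {m : ℕ} (hm : Nat.Coprime m (q * q')) :
    prodChar χ χ' m = χ m * χ' m := by
  have hmZ : IsCoprime (m : ℤ) ((q * q' : ℕ) : ℤ) := Nat.isCoprime_iff_coprime.mpr hm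
  have h1 := changeLevel_eq_cast_of_dvd' χ (dvd_mul_right q q') hmZ
  have h2 := changeLevel_eq_cast_of_dvd' χ' (dvd_mul_left q' q) hmZ
  simp only [Int.cast_natCast] at h1 h2
  rw [prodChar, MulChar.mul_apply, h1, h2]

/-- For quadratic `χ′`: `(χχ′)·χ′ = χ` at level `qq′`. [folklore] -/
private theorem prodChar_mul_right (h2' : χ' ^ 2 = 1) :
    prodChar χ χ' * changeLevel (dvd_mul_left q' q) χ' = changeLevel (dvd_mul_right q q') χ := by
  rw [prodChar, mul_assoc, ← sq, ← map_pow, h2', map_one, mul_one]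

/-- For quadratic `χ`: `(χχ′)·χ = χ′` at level `qq′`. [folklore] -/
private theorem prodChar_mul_left (h2 : χ ^ 2 = 1) :
    prodChar χ χ' * changeLevel (dvd_mul_right q q') χ = changeLevel (dvd_mul_left q' q) χ' := by
  rw [prodChar, mul_right_comm, ← sq, ← map_pow, h2, map_one, one_mul]

variable [NeZero q] [NeZero q']

/-- `NeZero (qq′)`. [folklore] -/
private lemma neZero_mul : NeZero (q * q') := ⟨mul_ne_zero (NeZero.ne q) (NeZero.ne q')⟩

/-- **The conductor divisibility**: for primitive `χ` mod `q` and primitive quadratic `χ′` mod `q′`,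
`q ∣ lcm(cond(χχ′), q′)` (`χ = (χχ′)·χ′` and the conductor of a product divides the lcm of the
conductors). Hence a prime dividing `q` but not `q′` divides the conductor of `χχ′`. [folklore] -/
private theorem level_dvd_lcm_conductor_prodChar (hχ : χ.IsPrimitive) (hχ' : χ'.IsPrimitive) (h2' : χ' ^ 2 = 1) :
    q ∣ Nat.lcm (prodChar χ χ').conductor q' := by
  haveI := neZero_mul (q := q) (q' := q')
  have h := conductor_mul_dvd_lcm_conductor (prodChar χ χ') (changeLevel (dvd_mul_left q' q) χ')
  rw [prodChar_mul_right χ χ' h2', conductor_changeLevel, conductor_changeLevel] at h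
  rwa [hχ, hχ'] at h

/-- Symmetrically, `q′ ∣ lcm(cond(χχ′), q)`. [folklore] -/
private theorem level_dvd_lcm_conductor_prodChar' (hχ : χ.IsPrimitive) (hχ' : χ'.IsPrimitive) (h2 : χ ^ 2 = 1) :
    q' ∣ Nat.lcm (prodChar χ χ').conductor q := by
  haveI := neZero_mul (q := q) (q' := q')
  have h := conductor_mul_dvd_lcm_conductor (prodChar χ χ') (changeLevel (dvd_mul_right q q') χ)
  rw [prodChar_mul_left χ χ' h2, conductor_changeLevel, conductor_changeLevel] at h
  rwa [hχ, hχ'] at h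

/-- A prime dividing `a` and `lcm(k, b)`-multiples: from `a ∣ lcm k b`, `p ∣ a`, `p ∤ b` infer `p ∣ k`. [folklore] -/
private lemma prime_dvd_of_dvd_lcm {p a k b : ℕ} (hp : p.Prime) (h : a ∣ Nat.lcm k b) (hpa : p ∣ a)
    (hpb : ¬ p ∣ b) : p ∣ k := by
  have h' : p ∣ k * b := (hpa.trans h).trans (Nat.lcm_dvd_mul _ _)
  rcases (Nat.Prime.dvd_mul hp).1 h' with h1 | h1
  · exact h1
  · exact absurd h1 hpb

/-- A prime `p ∣ q`, `p ∤ q′` divides the conductor of `χχ′` (for `χ, χ′` primitive, `χ′` quadratic).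
[folklore] -/
private theorem prime_dvd_conductor_prodChar (hχ : χ.IsPrimitive) (hχ' : χ'.IsPrimitive) (h2' : χ' ^ 2 = 1)
    {p : ℕ} (hp : p.Prime) (hpq : p ∣ q) (hpq' : ¬ p ∣ q') : p ∣ (prodChar χ χ').conductor :=
  prime_dvd_of_dvd_lcm hp (level_dvd_lcm_conductor_prodChar χ χ' hχ hχ' h2') hpq hpq'

/-- A prime `p ∣ q′`, `p ∤ q` divides the conductor of `χχ′` (for `χ, χ′` primitive, `χ` quadratic).
[folklore] -/
private theorem prime_dvd_conductor_prodChar' (hχ : χ.IsPrimitive) (hχ' : χ'.IsPrimitive) (h2 : χ ^ 2 = 1)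
    {p : ℕ} (hp : p.Prime) (hpq' : p ∣ q') (hpq : ¬ p ∣ q) : p ∣ (prodChar χ χ').conductor :=
  prime_dvd_of_dvd_lcm hp (level_dvd_lcm_conductor_prodChar' χ χ' hχ hχ' h2) hpq' hpq

/-- **The primitive character `ψ` inducing `χχ′`** (conductor `k ∣ qq′`), for primitive quadratic
`χ ≠ χ′` (as value functions): `ψ` is primitive, quadratic, non-trivial, of conductor `1 < k ∣ qq′`,
agrees with `χχ′` on integers coprime to `qq′`, and is LOCALLY LINKED to `(χ, χ′)`. This is the
third `L`-factor of `ζ_K` for `K = ℚ(√d, √d′)` ("`ζ_K(s) = ζ(s)L(s,χ)L(s,χ′)L(s,χχ′)`", with `χχ′`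
understood as the primitive character it induces). [cite: Hoffstein1980SiegelTatuzawa, §3 proof of Lemma 3 p. 170] -/
theorem exists_primitive_inducer (hχ : χ.IsPrimitive) (hχ' : χ'.IsPrimitive) (h2 : χ ^ 2 = 1)
    (h2' : χ' ^ 2 = 1) (hne : (fun n : ℕ ↦ χ n) ≠ fun n : ℕ ↦ χ' n) :
    ∃ k : ℕ, ∃ _ : NeZero k, ∃ ψ : DirichletCharacter ℂ k,
      1 < k ∧ k ∣ q * q' ∧ ψ.IsPrimitive ∧ ψ ^ 2 = 1 ∧ ψ ≠ 1 ∧ LocallyLinked χ χ' ψ ∧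
        (∀ m : ℕ, Nat.Coprime m (q * q') → ψ m = χ m * χ' m) := by
  haveI := neZero_mul (q := q) (q' := q')
  set Θ := prodChar χ χ' with hΘ
  set k := Θ.conductor with hk
  haveI hk0 : NeZero k := ⟨conductor_ne_zero Θ⟩
  set ψ := Θ.primitiveCharacter with hψ
  have hΘψ : changeLevel (conductor_dvd_level Θ) ψ = Θ := changeLevel_primitiveCharacter Θ
  -- values at integers coprime to `qq′`
  have hval : ∀ m : ℕ, Nat.Coprime m (q * q') → ψ m = χ m * χ' m := by
    intro m hm
    have hmZ : IsCoprime (m : ℤ) ((q * q' : ℕ) : ℤ) := Nat.isCoprime_iff_coprime.mpr hm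
    have h1 := primitiveCharacter_apply_of_isCoprime Θ hmZ
    simp only [Int.cast_natCast] at h1
    rw [h1, prodChar_apply_of_coprime χ χ' hm]
  -- `ψ² = 1`
  have hψ2 : ψ ^ 2 = 1 := by
    have h : changeLevel (conductor_dvd_level Θ) (ψ ^ 2) = 1 := by
      rw [map_pow, hΘψ, hΘ, prodChar, mul_pow, ← map_pow, ← map_pow, h2, h2', map_one, map_one, mul_one]
    exact (changeLevel_eq_one_iff _).1 h
  -- `ψ ≠ 1`
  have hψ1 : ψ ≠ 1 := by
    intro h1
    have hΘ1 : Θ = 1 := by rw [← hΘψ, h1, map_one]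
    -- `χ_N = χ′_N`, so `q = q′` and the value functions agree
    have hχχ' : changeLevel (dvd_mul_right q q') χ = changeLevel (dvd_mul_left q' q) χ' := by
      rw [← prodChar_mul_right χ χ' h2', ← hΘ, hΘ1, one_mul]
    have hqq' : q = q' := by
      have h := congrArg DirichletCharacter.conductor hχχ'
      rwa [conductor_changeLevel, conductor_changeLevel, hχ, hχ'] at h
    apply hne
    funext m
    by_cases hm : Nat.Coprime m (q * q')
    · have hmZ : IsCoprime (m : ℤ) ((q * q' : ℕ) : ℤ) := Nat.isCoprime_iff_coprime.mpr hm
      have e1 := changeLevel_eq_cast_of_dvd' χ (dvd_mul_right q q') hmZ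
      have e2 := changeLevel_eq_cast_of_dvd' χ' (dvd_mul_left q' q) hmZ
      simp only [Int.cast_natCast] at e1 e2
      rw [← e1, ← e2, hχχ']
    · have hmq : ¬ Nat.Coprime m q := fun h ↦ hm (by rw [← hqq']; exact Nat.Coprime.mul_right h h)
      have hmq' : ¬ Nat.Coprime m q' := by rwa [← hqq']
      rw [(apply_natCast_eq_zero_iff χ m).2 hmq, (apply_natCast_eq_zero_iff χ' m).2 hmq']
  -- `1 < k`
  have hk1 : 1 < k := by
    have hk0' : k ≠ 0 := conductor_ne_zero Θ
    have hk1' : k ≠ 1 := fun h ↦ hψ1 (DirichletCharacter.level_one' ψ h)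
    omega
  -- local linkage
  have hlink : LocallyLinked χ χ' ψ := by
    intro p hp
    refine ⟨fun ha hb ↦ ?_, fun ha hb ↦ ?_, fun hb ha ↦ ?_⟩
    · have haq : Nat.Coprime p q := by
        by_contra h; exact ha ((apply_natCast_eq_zero_iff χ p).2 h)
      have hbq : Nat.Coprime p q' := by
        by_contra h; exact hb ((apply_natCast_eq_zero_iff χ' p).2 h)
      exact hval p (Nat.Coprime.mul_right haq hbq)
    · have hpq : p ∣ q := by
        have h := (apply_natCast_eq_zero_iff χ p).1 ha
        rwa [Nat.Prime.coprime_iff_not_dvd hp, not_not] at h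
      have hpq' : ¬ p ∣ q' := by
        intro h
        exact hb ((apply_natCast_eq_zero_iff χ' p).2 ((Nat.Prime.coprime_iff_not_dvd hp).not.2 (not_not.2 h)))
      have hpk : p ∣ k := prime_dvd_conductor_prodChar χ χ' hχ hχ' h2' hp hpq hpq'
      exact (apply_natCast_eq_zero_iff ψ p).2 ((Nat.Prime.coprime_iff_not_dvd hp).not.2 (not_not.2 hpk))
    · have hpq' : p ∣ q' := by
        have h := (apply_natCast_eq_zero_iff χ' p).1 hb
        rwa [Nat.Prime.coprime_iff_not_dvd hp, not_not] at h
      have hpq : ¬ p ∣ q := by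
        intro h
        exact ha ((apply_natCast_eq_zero_iff χ p).2 ((Nat.Prime.coprime_iff_not_dvd hp).not.2 (not_not.2 h)))
      have hpk : p ∣ k := prime_dvd_conductor_prodChar' χ χ' hχ hχ' h2 hp hpq' hpq
      exact (apply_natCast_eq_zero_iff ψ p).2 ((Nat.Prime.coprime_iff_not_dvd hp).not.2 (not_not.2 hpk))
  exact ⟨k, hk0, ψ, hk1, conductor_dvd_level Θ, primitiveCharacter_isPrimitive Θ, hψ2, hψ1, hlink, hval⟩

end Inducer

end Literature.NumberTheory.LFunctions.Hoffstein1980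

end
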